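import Summits.QuantumFields.BalabanUV.T4Continuum.Support.CovariantVectorChartConjugationAvg

/-!
# T⁴ programme, SUBSTRATE (shared lattice-gauge analysis library) — COMBES–THOMAS DECAY ON THE COMPLEX CHART BALL, I: for a unitary reference
# field with `γ`-coercive real slice and `‖A‖ < rho1 (∋ rhoStar/n)`, the two-sided fluctuation operator `ΔQ_n(e^{A}R⁰, (R⁰)⁻¹e^{−A})` is
# WEIGHTED-COERCIVE with `γ/4 − Jch(κ)`, and its Green's function decays at every admissible rate `κ` (`Jch(κ) < γ/4`) in pairing, set-to-set
# and ENTRY form — the accretive route (typer LIBRARY-v0.1 item W-9 ∕ L-A7, file 3 of 4; explicit rate + tower corollary in file 4)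

Substrate cell `b2b-balaban-substrate-*`, seat p3 (gen 2).  Assembly of the accretive Combes–Thomas bound for the chart operator
`ΔQ_n(e^{A}R⁰, (R⁰)⁻¹e^{−A}) = vecOp n M a′ Γ R⁰ + [Laplacian perturbation] + [averaging perturbation]` (files 1–2
`CovariantVectorChartConjugation(Avg)`):
 * §1 the REAL-SLICE cosh budget at a UNITARY background (J-2's `CovariantVectorCTDefects` re-run with `‖R⁰‖ ≤ 1`, `‖T(Γ) − 1‖ ≤ 2`, no α∕τ letters):
   `ctRowDefect_covLapC_le_unitary`, **`J0u co d a′ κ L = co·d·κ²e^{κ²/2} + 9a′co²(cosh κL − 1)`**, `ctRowDefect_vecOp_le_unitary`,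
   `conjDefect_vecOp_unitary` (VEC-1's `conjDefect_of_rowDefect`);
 * §2 the total defect **`Jch`** `= J0u + Jlap + Javg` (`Jlap = d·2n²(e^{|κ|/n} − 1)·δ(1+δ)`, `Javg = a′|o|²θ_L E(2+θ_L)(6+E)`, `δ = ‖A‖e^{‖A‖}`,
   `E = Etr δ ℓ`, `θ_L = e^{|κ|L} − 1`), **`conjDefect_deltaQT_chart`** (`ConjDefect.add` of the three parts; the coarse companion weight is `ρ`
   at one stencil point per block), and **`wCoercive_deltaQT_chart`**: `‖A‖ < rho1 → WCoercive (ΔQ(chart)) κ ρ (γ/4 − Jch)` (HoloForm's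
   `coercive_deltaQT_of_norm_lt_rho1` + VEC-1's `wCoercive_of_coercive`);
 * §3 decay at any admissible rate: **`greenT_chart_pairing_decay`** (any bond weight with the two letters: `1/n`-Lipschitz, stencil oscillation
   `≤ L`), then with the distance-to-the-source weight of `DeltaACombesThomasSets` (`L = 2(d+1)` by `stencil_osc_of_lipschitz`, `2 ≤ n·M_μ`):
   **`greenT_chart_setDecay`** and **`greenT_chart_entry_decay`** (`‖G(e^{A}R⁰, (R⁰)⁻¹e^{−A})(i, i′)‖ ≤ e^{−κ·dist_∞(x,x′)/n}/(γ/4 − JchT)`).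
Letters: unitary `R⁰`, `0 ≤ a′`, `Coercive γ (vecOp n M a′ Γ R⁰)` (J-1's END shape), contours of length `≤ ℓ`, `‖A‖ < rho1 n d a′ |o| ℓ γ`.
HONEST FRAMING (T4-DAG p. 1).  MODEL-level finite-dimensional linear algebra ([folklore]: Combes–Thomas 1973 ∕ Agmon, accretive variant; constants
OURS and crude); no estimate of any NE row; nothing printed is a hypothesis; the `def`s are explicit real budget functions (no `def … : Prop`);
spine 0/9 unchanged; NOT infinite volume ∕ mass gap ∕ Clay.  HONEST DEPENDENCY: continuum YM on T⁴ ⇐ BetaPertH ∧ nine spine estimates (0/9 proved);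
BetaPertH ⇐ (D1) ∧ (D4) ∧ CAP+tail; G-an2-4 gates asym, D1 and NE2/3/4.  ABSOLUTE RULE kept; no `sorry`.
-/

noncomputable section

open scoped BigOperators ComplexConjugate Matrix Matrix.Norms.L2Operator Kronecker ComplexOrder

namespace Summit.QuantumFields.BalabanUV.T4Continuum.CovariantVectorGreenDecayChart

open Literature.MathematicalPhysics.QuantumFieldTheory.Balaban1983to89.B5Prop11Plancherel (Tor fine unitVec shiftM)
open Literature.MathematicalPhysics.QuantumFieldTheory.Balaban1983to89.B5Prop11Lower (nsq nsq_nonneg)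
open Literature.MathematicalPhysics.QuantumFieldTheory.Balaban1983to89.B5Block118 (bpt tstep)
open Literature.MathematicalPhysics.QuantumFieldTheory.Balaban1983to89.Beta.DeltaACombesThomas (ctRowDefect ctRowDefect_add_le ctRowDefect_smul
  ctRowDefect_sub_le qr qr_ne_zero sq_mul_cosh_div_sub_one_le)
open Literature.MathematicalPhysics.QuantumFieldTheory.Balaban1983to89.Beta.DeltaACombesThomasSets (rhoT rhoT_lipschitz rhoT_le_zero_of_mem le_rhoT
  stencil_osc_of_lipschitz)
open Literature.MathematicalPhysics.QuantumFieldTheory.Balaban1983to89.Beta.TorusG0Decay (ldist)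
open Summit.QuantumFields.BalabanUV.T4Continuum
open Summit.QuantumFields.BalabanUV.Beta.AccretiveCombesThomas (nsq_single)
open Summit.QuantumFields.BalabanUV.T4Continuum.BlockMultiplication (siteMul)
open Summit.QuantumFields.BalabanUV.T4Continuum.AbelianCovariantLaplacian (tauInv)
open Summit.QuantumFields.BalabanUV.T4Continuum.ColourCovariantLaplacian (covDc covLapC)
open Summit.QuantumFields.BalabanUV.T4Continuum.CovariantBlockAveraging (transport ContourSystem Qcov)
open Summit.QuantumFields.BalabanUV.T4Continuum.CoerciveInverseTower (Coercive)
open Summit.QuantumFields.BalabanUV.T4Continuum.SubstrateTransporterSpecies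
open Summit.QuantumFields.BalabanUV.T4Continuum.CovariantVectorCoercive (vecOp vecOp_isHermitian)
open Summit.QuantumFields.BalabanUV.T4Continuum.CovariantVectorCTDefects (rhoV ctRowDefect_siteMul_eq_zero ctRowDefect_one_eq_zero
  ctRowDefect_siteMul_kronShiftM_le ctRowDefect_siteMul_kronShiftM_adj_le ctRowDefect_finset_sum_le covDc_sq_eq ctRowDefect_mass_le)
open Summit.QuantumFields.BalabanUV.T4Continuum.CovariantVectorGreenDecay (cosh_mul_sub_one_le_linear sq_mul_exp_le_two_mul)
open Summit.QuantumFields.BalabanUV.T4Continuum.CovariantVectorCoerciveHolo (deltaQT_adjOf_eq_vecOp InHoloBallT inHoloBallT_apply)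
open Summit.QuantumFields.BalabanUV.T4Continuum.CovariantVectorChartModulus (norm_of_unitary)
open Summit.QuantumFields.BalabanUV.T4Continuum.CovariantVectorChartFactorisation (Etr Etr_nonneg)
open Summit.QuantumFields.BalabanUV.T4Continuum.CovariantVectorCoerciveHoloForm (rho1 rho1_pos coercive_deltaQT_of_norm_lt_rho1 rhoStar rhoStar_pos
  rhoStar_div_le_rho1)
open Summit.QuantumFields.BalabanUV.T4Continuum.CTWeightedCoercivity (ConjDefect ConjDefect.add conjDefect_of_rowDefect WCoercive wCoercive_of_coercive)
open Summit.QuantumFields.BalabanUV.T4Continuum.CovariantVectorChartConjugation (conjDefect_covLapT_chart)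
open Summit.QuantumFields.BalabanUV.T4Continuum.CovariantVectorChartConjugationAvg (norm_transport_sub_one_le_two conjDefect_avg_chart)

variable {d : ℕ} {o : Type*} [Fintype o] [DecidableEq o] [Nonempty o]

/-! ## §1 The real-slice cosh budget at a unitary background -/

section RealSlice

variable (n : ℕ) [NeZero n] (M : Fin d → ℕ) [hM : ∀ μ, NeZero (M μ)]
variable {ρ : Tor (fine n M) × Fin d → ℝ} {κ : ℝ} {R₀ : Fin d → (Tor (fine n M) × Fin d → Matrix o o ℂ)} {Γ : ContourSystem d n M} {a' L : ℝ}

/-- **ROW DEFECT OF THE COVARIANT VECTOR LAPLACIAN AT A UNITARY BACKGROUND**: `defect(Δ_{R⁰}) ≤ |o|·d·κ²·e^{κ²/2}` for a `1/n`-Lipschitz bond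
weight (J-2's `ctRowDefect_covLapC_le` with `‖R⁰_ν‖ ≤ 1` in place of the small-field letter `α`). [folklore] -/
theorem ctRowDefect_covLapC_le_unitary (hR₀ : ∀ ν i, R₀ ν i ∈ Matrix.unitaryGroup o ℂ)
    (hlip : ∀ x μ ν', |ρ (x + unitVec (fine n M) ν', μ) - ρ (x, μ)| ≤ 1 / n) (i : (Tor (fine n M) × Fin d) × o) :
    ctRowDefect (covLapC (fine n M) ((n : ℕ) : ℂ) R₀) κ (rhoV n M ρ) i ≤ Fintype.card o * d * (κ ^ 2 * Real.exp (κ ^ 2 / 2)) := by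
  have hn1 : 1 ≤ n := Nat.one_le_iff_ne_zero.mpr (NeZero.ne n)
  have hR' : ∀ ν k, ‖R₀ ν k‖ ≤ 1 := fun ν k => (norm_of_unitary (hR₀ ν k)).le
  -- per direction
  have hdir : ∀ ν, ctRowDefect ((covDc (fine n M) ((n : ℕ) : ℂ) R₀ ν)ᴴ * covDc (fine n M) ((n : ℕ) : ℂ) R₀ ν) κ (rhoV n M ρ) i
      ≤ (n : ℝ) ^ 2 * (2 * (Fintype.card o * 1 * (Real.cosh (κ * (1 / n)) - 1))) := by
    intro ν
    rw [covDc_sq_eq, ctRowDefect_smul, norm_mul, Complex.norm_conj, Complex.norm_natCast, ← sq]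
    refine mul_le_mul_of_nonneg_left ?_ (sq_nonneg _)
    set Z : Matrix ((Tor (fine n M) × Fin d) × o) ((Tor (fine n M) × Fin d) × o) ℂ :=
      siteMul (fun i => (R₀ ν (tauInv (fine n M) ν i))ᴴ * R₀ ν (tauInv (fine n M) ν i)) with hZ
    set DS : Matrix ((Tor (fine n M) × Fin d) × o) ((Tor (fine n M) × Fin d) × o) ℂ := siteMul (R₀ ν) * shiftM (fine n M) ν ⊗ₖ (1 : Matrix o o ℂ)
      with hDS
    have hA : ctRowDefect Z κ (rhoV n M ρ) i = 0 := ctRowDefect_siteMul_eq_zero n M _ κ ρ i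
    have hB : ctRowDefect (1 : Matrix ((Tor (fine n M) × Fin d) × o) ((Tor (fine n M) × Fin d) × o) ℂ) κ (rhoV n M ρ) i = 0 :=
      ctRowDefect_one_eq_zero n M κ ρ i
    have hC : ctRowDefect DS κ (rhoV n M ρ) i ≤ Fintype.card o * 1 * (Real.cosh (κ * (1 / n)) - 1) :=
      ctRowDefect_siteMul_kronShiftM_le n M (R₀ ν) ν zero_le_one hlip (hR' ν) i
    have hD : ctRowDefect DSᴴ κ (rhoV n M ρ) i ≤ Fintype.card o * 1 * (Real.cosh (κ * (1 / n)) - 1) :=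
      ctRowDefect_siteMul_kronShiftM_adj_le n M (R₀ ν) ν zero_le_one hlip (hR' ν) i
    have h1 := ctRowDefect_sub_le (Z + 1 - DS) DSᴴ κ (rhoV n M ρ) i
    have h2 := ctRowDefect_sub_le (Z + 1) DS κ (rhoV n M ρ) i
    have h3 := ctRowDefect_add_le Z 1 κ (rhoV n M ρ) i
    linarith
  have hcosh := sq_mul_cosh_div_sub_one_le n κ hn1
  have hkey : (n : ℝ) ^ 2 * (2 * (Fintype.card o * 1 * (Real.cosh (κ * (1 / n)) - 1))) ≤ Fintype.card o * (κ ^ 2 * Real.exp (κ ^ 2 / 2)) := by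
    have e1 : κ * (1 / (n : ℝ)) = κ / n := by ring
    rw [e1]
    calc (n : ℝ) ^ 2 * (2 * (Fintype.card o * 1 * (Real.cosh (κ / n) - 1)))
        = 2 * Fintype.card o * ((n : ℝ) ^ 2 * (Real.cosh (κ / n) - 1)) := by ring
      _ ≤ 2 * Fintype.card o * (κ ^ 2 / 2 * Real.exp (κ ^ 2 / 2)) := mul_le_mul_of_nonneg_left hcosh (by positivity)
      _ = Fintype.card o * (κ ^ 2 * Real.exp (κ ^ 2 / 2)) := by ring
  calc ctRowDefect (covLapC (fine n M) ((n : ℕ) : ℂ) R₀) κ (rhoV n M ρ) i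
      ≤ ∑ ν, ctRowDefect ((covDc (fine n M) ((n : ℕ) : ℂ) R₀ ν)ᴴ * covDc (fine n M) ((n : ℕ) : ℂ) R₀ ν) κ (rhoV n M ρ) i :=
        ctRowDefect_finset_sum_le _ _ κ _ i
    _ ≤ ∑ _ν : Fin d, (Fintype.card o : ℝ) * (κ ^ 2 * Real.exp (κ ^ 2 / 2)) := Finset.sum_le_sum fun ν _ => (hdir ν).trans hkey
    _ = Fintype.card o * d * (κ ^ 2 * Real.exp (κ ^ 2 / 2)) := by
        rw [Finset.sum_const, Finset.card_univ, Fintype.card_fin, nsmul_eq_mul]; ring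

/-- **THE REAL-SLICE BUDGET AT A UNITARY BACKGROUND** `J0u co d a′ κ L = co·d·κ²e^{κ²/2} + 9·a′·co²·(cosh κL − 1)`. [folklore] -/
def J0u (co d : ℕ) (a' κ L : ℝ) : ℝ := co * d * (κ ^ 2 * Real.exp (κ ^ 2 / 2)) + 9 * a' * (co : ℝ) ^ 2 * (Real.cosh (κ * L) - 1)

omit [Fintype o] [DecidableEq o] [Nonempty o] [NeZero n] hM in
/-- `J0u ≥ 0` (`a′ ≥ 0`). [folklore] -/
theorem J0u_nonneg (co d : ℕ) {a' : ℝ} (ha' : 0 ≤ a') (κ L : ℝ) : 0 ≤ J0u co d a' κ L := by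
  have : 0 ≤ Real.cosh (κ * L) - 1 := by linarith [Real.one_le_cosh (κ * L)]
  unfold J0u; positivity

/-- **ROW DEFECT OF `vecOp` AT A UNITARY BACKGROUND**: `≤ J0u |o| d a′ κ L` for a `1/n`-Lipschitz bond weight oscillating by `≤ L` on the block stencils.
[folklore] -/
theorem ctRowDefect_vecOp_le_unitary (hR₀ : ∀ ν i, R₀ ν i ∈ Matrix.unitaryGroup o ℂ) (ha' : 0 ≤ a')
    (hlip : ∀ x μ ν', |ρ (x + unitVec (fine n M) ν', μ) - ρ (x, μ)| ≤ 1 / n)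
    (hL : ∀ (y : Tor M) (μ : Fin d) (j j' : Fin d → Fin n) (t t' : Fin n),
      |ρ (bpt n M y j + tstep (fine n M) μ t, μ) - ρ (bpt n M y j' + tstep (fine n M) μ t', μ)| ≤ L)
    (i : (Tor (fine n M) × Fin d) × o) : ctRowDefect (vecOp n M a' Γ R₀) κ (rhoV n M ρ) i ≤ J0u (Fintype.card o) d a' κ L := by
  have hR' : ∀ ν k, ‖R₀ ν k‖ ≤ 1 := fun ν k => (norm_of_unitary (hR₀ ν k)).le
  have hT2 : ∀ y j μ (t : Fin n), ‖transport (fine n M) R₀ μ (Γ y j μ t) - 1‖ ≤ 2 := fun y j μ t => norm_transport_sub_one_le_two n M hR' μ _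
  rw [vecOp, J0u]
  refine (ctRowDefect_add_le _ _ κ _ i).trans (add_le_add (ctRowDefect_covLapC_le_unitary n M hR₀ hlip i) ?_)
  have h := ctRowDefect_mass_le n M (κ := κ) ha' zero_le_two hT2 hL i
  refine h.trans (le_of_eq ?_); ring

/-- **CONJUGATION DEFECT OF THE REAL SLICE** (Hermitian: the cosh symmetrisation). [folklore] -/
theorem conjDefect_vecOp_unitary (hR₀ : ∀ ν i, R₀ ν i ∈ Matrix.unitaryGroup o ℂ) (ha' : 0 ≤ a')
    (hlip : ∀ x μ ν', |ρ (x + unitVec (fine n M) ν', μ) - ρ (x, μ)| ≤ 1 / n)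
    (hL : ∀ (y : Tor M) (μ : Fin d) (j j' : Fin d → Fin n) (t t' : Fin n),
      |ρ (bpt n M y j + tstep (fine n M) μ t, μ) - ρ (bpt n M y j' + tstep (fine n M) μ t', μ)| ≤ L) :
    ConjDefect (vecOp n M a' Γ R₀) κ (rhoV n M ρ) (J0u (Fintype.card o) d a' κ L) :=
  conjDefect_of_rowDefect (vecOp_isHermitian n M a' Γ R₀) fun e => ctRowDefect_vecOp_le_unitary n M hR₀ ha' hlip hL e

end RealSlice

/-! ## §2 The total defect and the weighted coercivity on the chart ball -/

section Total

/-- **THE LAPLACIAN BUDGET** `Jlap d n κ t = d·(2n²(e^{|κ|/n} − 1)·δ(1+δ))`, `δ = t·e^t`. [folklore] -/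
def Jlap (d n : ℕ) (κ t : ℝ) : ℝ :=
  d * (2 * (n : ℝ) ^ 2 * (Real.exp (|κ| * (1 / n)) - 1) * ((t * Real.exp t) * (1 + t * Real.exp t)))

/-- **THE AVERAGING BUDGET** `Javg co ℓ a′ κ L t = a′·(co²·θ·E·(2+θ)·(6+E))`, `θ = e^{|κ|L} − 1`, `E = Etr (t·e^t) ℓ`. [folklore] -/
def Javg (co ℓ : ℕ) (a' κ L t : ℝ) : ℝ :=
  a' * ((co : ℝ) ^ 2 * (Real.exp (|κ| * L) - 1) * Etr (t * Real.exp t) ℓ * (2 + (Real.exp (|κ| * L) - 1)) * (6 + Etr (t * Real.exp t) ℓ))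

/-- **THE TOTAL CHART BUDGET** `Jch co d n ℓ a′ κ L t = J0u + Jlap + Javg`. [folklore] -/
def Jch (co d n ℓ : ℕ) (a' κ L t : ℝ) : ℝ := J0u co d a' κ L + Jlap d n κ t + Javg co ℓ a' κ L t

omit [Fintype o] [DecidableEq o] [Nonempty o] in
/-- `Jlap ≥ 0` for `t ≥ 0`. [folklore] -/
theorem Jlap_nonneg (d n : ℕ) (κ : ℝ) {t : ℝ} (ht : 0 ≤ t) : 0 ≤ Jlap d n κ t := by
  have : 0 ≤ Real.exp (|κ| * (1 / (n : ℝ))) - 1 := by linarith [Real.one_le_exp (by positivity : 0 ≤ |κ| * (1 / (n : ℝ)))]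
  unfold Jlap; positivity

omit [Fintype o] [DecidableEq o] [Nonempty o] in
/-- `Javg ≥ 0` for `a′, L, t ≥ 0`. [folklore] -/
theorem Javg_nonneg (co ℓ : ℕ) {a' : ℝ} (ha' : 0 ≤ a') (κ : ℝ) {L t : ℝ} (hL : 0 ≤ L) (ht : 0 ≤ t) : 0 ≤ Javg co ℓ a' κ L t := by
  have h1 : 0 ≤ Real.exp (|κ| * L) - 1 := by linarith [Real.one_le_exp (mul_nonneg (abs_nonneg κ) hL)]
  have h2 : 0 ≤ Etr (t * Real.exp t) ℓ := Etr_nonneg (by positivity) ℓ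
  unfold Javg; positivity

omit [Fintype o] [DecidableEq o] [Nonempty o] in
/-- `Jch ≥ 0`. [folklore] -/
theorem Jch_nonneg (co d n ℓ : ℕ) {a' : ℝ} (ha' : 0 ≤ a') (κ : ℝ) {L t : ℝ} (hL : 0 ≤ L) (ht : 0 ≤ t) : 0 ≤ Jch co d n ℓ a' κ L t := by
  unfold Jch
  exact add_nonneg (add_nonneg (J0u_nonneg co d ha' κ L) (Jlap_nonneg d n κ ht)) (Javg_nonneg co ℓ ha' κ hL ht)

variable (n : ℕ) [NeZero n] (M : Fin d → ℕ) [hM : ∀ μ, NeZero (M μ)]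
variable {ρ : Tor (fine n M) × Fin d → ℝ} {R₀ : Fin d → (Tor (fine n M) × Fin d → Matrix o o ℂ)} {Γ : ContourSystem d n M} {ℓ : ℕ} {a' L : ℝ}

/-- **CONJUGATION DEFECT OF THE CHART OPERATOR**: for unitary `R⁰`, `a′ ≥ 0`, contours of length `≤ ℓ`, a `1/n`-Lipschitz bond weight
oscillating by `≤ L` (`L ≥ 0`) on the block stencils:
`ConjDefect (ΔQ_n(e^{A}R⁰, (R⁰)⁻¹e^{−A})) κ ρ (Jch |o| d n ℓ a′ κ L ‖A‖)`. [folklore] -/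
theorem conjDefect_deltaQT_chart (hR₀ : ∀ ν i, R₀ ν i ∈ Matrix.unitaryGroup o ℂ) (hΓ : ∀ y j μ (t : Fin n), (Γ y j μ t).length ≤ ℓ) (ha' : 0 ≤ a')
    (hlip : ∀ x μ ν', |ρ (x + unitVec (fine n M) ν', μ) - ρ (x, μ)| ≤ 1 / n) (hL0 : 0 ≤ L)
    (hL : ∀ (y : Tor M) (μ : Fin d) (j j' : Fin d → Fin n) (t t' : Fin n),
      |ρ (bpt n M y j + tstep (fine n M) μ t, μ) - ρ (bpt n M y j' + tstep (fine n M) μ t', μ)| ≤ L)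
    (κ : ℝ) (A : Fin d → (Tor (fine n M) × Fin d → Matrix o o ℂ)) :
    ConjDefect (deltaQT n M ((n : ℕ) : ℂ) (a' * (n : ℝ) ^ d) Γ (expChart R₀ A) (expChartInv R₀ A)) κ (rhoV n M ρ)
      (Jch (Fintype.card o) d n ℓ a' κ L ‖A‖) := by
  -- the coarse companion weight: `ρ` at one stencil point of each block
  set σ : Tor M × Fin d → ℝ := fun b => ρ (bpt n M b.1 (fun _ => 0) + tstep (fine n M) b.2 0, b.2) with hσdef
  have hσ : ∀ b i, qr n M b i ≠ 0 → |σ b - ρ i| ≤ L := by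
    intro b i hq
    obtain ⟨j, t, hi⟩ := qr_ne_zero n M b i hq
    rw [hi, hσdef]
    exact hL b.1 b.2 (fun _ => 0) j 0 t
  -- the decomposition `ΔQ(chart) = vecOp + [Laplacian perturbation] + [averaging perturbation]`
  have e : deltaQT n M ((n : ℕ) : ℂ) (a' * (n : ℝ) ^ d) Γ (expChart R₀ A) (expChartInv R₀ A)
      = vecOp n M a' Γ R₀ + (covLapT (fine n M) ((n : ℕ) : ℂ) (expChart R₀ A) (expChartInv R₀ A) - covLapC (fine n M) ((n : ℕ) : ℂ) R₀)
        + (((a' * (n : ℝ) ^ d : ℝ)) : ℂ) • (QcovA n M Γ (expChartInv R₀ A) * Qcov n M Γ (expChart R₀ A) - QcovA n M Γ (adjOf R₀) * Qcov n M Γ R₀) := by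
    rw [← deltaQT_adjOf_eq_vecOp, deltaQT, deltaQT, covLapT_adjOf, smul_sub]
    abel
  rw [e, Jch]
  have h1 := conjDefect_vecOp_unitary n M (κ := κ) (Γ := Γ) hR₀ ha' hlip hL
  have h2 := conjDefect_covLapT_chart n M (ρ := ρ) hR₀ hlip κ ((n : ℕ) : ℂ) A
  have h3 := conjDefect_avg_chart n M (ρ := ρ) (Γ := Γ) hR₀ hΓ hL0 hσ κ ha' A
  have h12 := (h1.add h2).add h3
  refine fun z => (h12 z).trans (le_of_eq ?_)
  rw [Jlap, Javg, Complex.norm_natCast]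

/-- **WEIGHTED COERCIVITY ON THE CHART BALL**: with `γ`-coercive real slice and `‖A‖ < rho1`,
`WCoercive (ΔQ_n(e^{A}R⁰, (R⁰)⁻¹e^{−A})) κ ρ (γ/4 − Jch |o| d n ℓ a′ κ L ‖A‖)`. [folklore] -/
theorem wCoercive_deltaQT_chart (hR₀ : ∀ ν i, R₀ ν i ∈ Matrix.unitaryGroup o ℂ) (hΓ : ∀ y j μ (t : Fin n), (Γ y j μ t).length ≤ ℓ) (ha' : 0 ≤ a')
    {γ : ℝ} (hco : Coercive γ (vecOp n M a' Γ R₀)) (hγ : 0 < γ)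
    (hlip : ∀ x μ ν', |ρ (x + unitVec (fine n M) ν', μ) - ρ (x, μ)| ≤ 1 / n) (hL0 : 0 ≤ L)
    (hL : ∀ (y : Tor M) (μ : Fin d) (j j' : Fin d → Fin n) (t t' : Fin n),
      |ρ (bpt n M y j + tstep (fine n M) μ t, μ) - ρ (bpt n M y j' + tstep (fine n M) μ t', μ)| ≤ L)
    (κ : ℝ) {A : Fin d → (Tor (fine n M) × Fin d → Matrix o o ℂ)} (hA : ‖A‖ < rho1 n d a' (Fintype.card o) ℓ γ) :
    WCoercive (deltaQT n M ((n : ℕ) : ℂ) (a' * (n : ℝ) ^ d) Γ (expChart R₀ A) (expChartInv R₀ A)) κ (rhoV n M ρ)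
      (γ / 4 - Jch (Fintype.card o) d n ℓ a' κ L ‖A‖) :=
  wCoercive_of_coercive (coercive_deltaQT_of_norm_lt_rho1 n M hR₀ Γ hΓ ha' hco hγ hA) (conjDefect_deltaQT_chart n M hR₀ hΓ ha' hlip hL0 hL κ A)

end Total

/-! ## §3 Decay at any admissible rate -/

section Decay

variable (n : ℕ) [NeZero n] (M : Fin d → ℕ) [hM : ∀ μ, NeZero (M μ)]
variable {ρ : Tor (fine n M) × Fin d → ℝ} {R₀ : Fin d → (Tor (fine n M) × Fin d → Matrix o o ℂ)} {Γ : ContourSystem d n M} {ℓ : ℕ} {a' L γ κ : ℝ}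

/-- **PAIRING DECAY OF `G(e^{A}R⁰, (R⁰)⁻¹e^{−A})`** for any bond weight with the two letters and any rate with `Jch < γ/4`:
`|⟨u, G v⟩| ≤ e^{−κr}/(γ/4 − Jch)·‖u‖‖v‖` for `v` supported in `{ρ ≤ 0}`, `u` in `{ρ ≥ r}`. [folklore] -/
theorem greenT_chart_pairing_decay (hR₀ : ∀ ν i, R₀ ν i ∈ Matrix.unitaryGroup o ℂ) (hΓ : ∀ y j μ (t : Fin n), (Γ y j μ t).length ≤ ℓ) (ha' : 0 ≤ a')
    (hco : Coercive γ (vecOp n M a' Γ R₀)) (hγ : 0 < γ)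
    (hlip : ∀ x μ ν', |ρ (x + unitVec (fine n M) ν', μ) - ρ (x, μ)| ≤ 1 / n) (hL0 : 0 ≤ L)
    (hL : ∀ (y : Tor M) (μ : Fin d) (j j' : Fin d → Fin n) (t t' : Fin n),
      |ρ (bpt n M y j + tstep (fine n M) μ t, μ) - ρ (bpt n M y j' + tstep (fine n M) μ t', μ)| ≤ L)
    {A : Fin d → (Tor (fine n M) × Fin d → Matrix o o ℂ)} (hA : ‖A‖ < rho1 n d a' (Fintype.card o) ℓ γ)
    (hκ : 0 ≤ κ) (hJ : Jch (Fintype.card o) d n ℓ a' κ L ‖A‖ < γ / 4)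
    {u v : (Tor (fine n M) × Fin d) × o → ℂ} {r : ℝ} (hu : ∀ i, u i ≠ 0 → r ≤ ρ i.1) (hv : ∀ i, v i ≠ 0 → ρ i.1 ≤ 0) :
    ‖star u ⬝ᵥ (greenT n M ((n : ℕ) : ℂ) (a' * (n : ℝ) ^ d) Γ (expChart R₀ A) (expChartInv R₀ A) *ᵥ v)‖
      ≤ Real.exp (-(κ * r)) / (γ / 4 - Jch (Fintype.card o) d n ℓ a' κ L ‖A‖) * (Real.sqrt (nsq u) * Real.sqrt (nsq v)) := by
  rw [greenT]
  exact (wCoercive_deltaQT_chart n M hR₀ hΓ ha' hco hγ hlip hL0 hL κ hA).pairing_decay_inv (by linarith) hκ hu hv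

/-- the budget at the stencil oscillation `2(d+1)` of the distance weight. [folklore] -/
abbrev JchT (co d n ℓ : ℕ) (a' κ t : ℝ) : ℝ := Jch co d n ℓ a' κ (2 * ((d : ℝ) + 1)) t

/-- **SET-TO-SET DECAY**: `v` supported on bonds based in `T`, `u` on bonds at sup-distance `≥ n·r` from `T`:
`|⟨u, G v⟩| ≤ e^{−κr}/(γ/4 − JchT)·‖u‖‖v‖` (needs `2 ≤ n·M_μ`). [folklore] -/
theorem greenT_chart_setDecay (hR₀ : ∀ ν i, R₀ ν i ∈ Matrix.unitaryGroup o ℂ) (hΓ : ∀ y j μ (t : Fin n), (Γ y j μ t).length ≤ ℓ) (ha' : 0 ≤ a')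
    (hco : Coercive γ (vecOp n M a' Γ R₀)) (hγ : 0 < γ) (h2 : ∀ μ, 2 ≤ fine n M μ)
    {A : Fin d → (Tor (fine n M) × Fin d → Matrix o o ℂ)} (hA : ‖A‖ < rho1 n d a' (Fintype.card o) ℓ γ)
    (T : Finset (Tor (fine n M))) (hTne : T.Nonempty) (hκ : 0 ≤ κ) (hJ : JchT (Fintype.card o) d n ℓ a' κ ‖A‖ < γ / 4)
    {u v : (Tor (fine n M) × Fin d) × o → ℂ} {r : ℝ} (hv : ∀ i, v i ≠ 0 → i.1.1 ∈ T) (hu : ∀ i, u i ≠ 0 → ∀ t ∈ T, (n : ℝ) * r ≤ ldist (fine n M) i.1.1 t) :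
    ‖star u ⬝ᵥ (greenT n M ((n : ℕ) : ℂ) (a' * (n : ℝ) ^ d) Γ (expChart R₀ A) (expChartInv R₀ A) *ᵥ v)‖
      ≤ Real.exp (-(κ * r)) / (γ / 4 - JchT (Fintype.card o) d n ℓ a' κ ‖A‖) * (Real.sqrt (nsq u) * Real.sqrt (nsq v)) := by
  have hn0 : (0 : ℝ) < n := by exact_mod_cast Nat.pos_of_ne_zero (NeZero.ne n)
  have hc : (0 : ℝ) ≤ 1 / n := by positivity
  have hℓ : ∀ (x : Tor (fine n M)) (μ : Fin d) (ν : Fin d),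
      |rhoT T hTne (1 / n) (x + unitVec (fine n M) ν, μ) - rhoT T hTne (1 / n) (x, μ)| ≤ 1 / n := by
    intro x μ ν
    have h := rhoT_lipschitz h2 T hTne (1 / n) x μ ν
    rwa [abs_of_nonneg hc] at h
  have hL : ∀ (y : Tor M) (μ : Fin d) (j j' : Fin d → Fin n) (t t' : Fin n),
      |rhoT T hTne (1 / n) (bpt n M y j + tstep (fine n M) μ t, μ) - rhoT T hTne (1 / n) (bpt n M y j' + tstep (fine n M) μ t', μ)|
        ≤ 2 * ((d : ℝ) + 1) := by
    intro y μ j j' t t'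
    have h := stencil_osc_of_lipschitz n M (rhoT T hTne (1 / n)) hc hℓ y μ j j' t t'
    have heq : 2 * (((d : ℝ) + 1) * n) * (1 / n) = 2 * ((d : ℝ) + 1) := by field_simp
    rwa [heq] at h
  refine greenT_chart_pairing_decay n M hR₀ hΓ ha' hco hγ hℓ (by positivity) hL hA hκ hJ ?_ ?_
  · intro i hi
    have h := le_rhoT T hTne hc (e := i.1) (hu i hi)
    have heq : 1 / (n : ℝ) * (n * r) = r := by field_simp
    rwa [heq] at h
  · intro i hi
    exact rhoT_le_zero_of_mem T hTne hc (hv i hi)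

/-- **ENTRY DECAY**: `‖G(e^{A}R⁰, (R⁰)⁻¹e^{−A})(i, i′)‖ ≤ e^{−κ·dist_∞(x,x′)/n}/(γ/4 − JchT)` (`x = i.1.1`, `x′ = i′.1.1`). [folklore] -/
theorem greenT_chart_entry_decay (hR₀ : ∀ ν i, R₀ ν i ∈ Matrix.unitaryGroup o ℂ) (hΓ : ∀ y j μ (t : Fin n), (Γ y j μ t).length ≤ ℓ) (ha' : 0 ≤ a')
    (hco : Coercive γ (vecOp n M a' Γ R₀)) (hγ : 0 < γ) (h2 : ∀ μ, 2 ≤ fine n M μ)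
    {A : Fin d → (Tor (fine n M) × Fin d → Matrix o o ℂ)} (hA : ‖A‖ < rho1 n d a' (Fintype.card o) ℓ γ)
    (hκ : 0 ≤ κ) (hJ : JchT (Fintype.card o) d n ℓ a' κ ‖A‖ < γ / 4) (i i' : (Tor (fine n M) × Fin d) × o) :
    ‖greenT n M ((n : ℕ) : ℂ) (a' * (n : ℝ) ^ d) Γ (expChart R₀ A) (expChartInv R₀ A) i i'‖
      ≤ Real.exp (-(κ * (ldist (fine n M) i.1.1 i'.1.1 / n))) / (γ / 4 - JchT (Fintype.card o) d n ℓ a' κ ‖A‖) := by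
  have hn0 : (0 : ℝ) < n := by exact_mod_cast Nat.pos_of_ne_zero (NeZero.ne n)
  set G := greenT n M ((n : ℕ) : ℂ) (a' * (n : ℝ) ^ d) Γ (expChart R₀ A) (expChartInv R₀ A) with hG
  have h := greenT_chart_setDecay n M hR₀ hΓ ha' hco hγ h2 hA {i'.1.1} (Finset.singleton_nonempty _) hκ hJ
    (u := Pi.single i (1 : ℂ)) (v := Pi.single i' (1 : ℂ)) (r := ldist (fine n M) i.1.1 i'.1.1 / n)
    (fun x hx => by
      have hxe : x = i' := by by_contra hne; exact hx (by simp [hne])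
      simp [hxe])
    (fun x hx t ht => by
      have hxe : x = i := by by_contra hne; exact hx (by simp [hne])
      rw [Finset.mem_singleton] at ht
      rw [hxe, ht]
      have : (n : ℝ) * (ldist (fine n M) i.1.1 i'.1.1 / n) = ldist (fine n M) i.1.1 i'.1.1 := by field_simp
      rw [this])
  have h1 : star (Pi.single i (1 : ℂ)) ⬝ᵥ (G *ᵥ Pi.single i' (1 : ℂ)) = G i i' := by
    rw [Matrix.mulVec_single_one, ← Pi.single_star, star_one, single_dotProduct, one_mul, Matrix.col_apply]
  rw [← hG, h1, nsq_single, nsq_single, Real.sqrt_one, mul_one, mul_one] at h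
  exact h

end Decay

end Summit.QuantumFields.BalabanUV.T4Continuum.CovariantVectorGreenDecayChart

end
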